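import Summits.ResolutionOfSingularities.ResolutionOfSingularities.Theorems.FrobeniusClosingSteerCompletionRecognition
import Summits.ResolutionOfSingularities.ResolutionOfSingularities.Theorems.FrobeniusClosingSteerRadicandCohenFrame
import Summits.ResolutionOfSingularities.ResolutionOfSingularities.Theorems.FrobeniusClosingSteerChartMonomialSubst
import Literature.AlgebraicGeometry.Resolution.FormalFibresRegularProofs
import Literature.RingTheory.CompleteLocalRings.CoefficientField
import HarnessLib

/-!
# Crux `Steer` (stmt-ResolutionOfSingularities-16345), chain W4.1, hGW3 WORK-MODULO: NESTED COHEN FRAMES along a RATIONAL local homomorphism with MONOMIAL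
# relations between the parameters (the completed chart square WITHOUT perfectness of the residue field)

OURS (campaign `res-hironaka`, rung L ★L-G4, slot W4.1; seat res-L0-w41-stub-2 g6, res-L0-w41-plan-1 RULINGs 165b (F♭_λ bridge) / 185h K-GG2 (rational case);
spec = res-L0-w41-idea-3 `G-GEOM-DIRECT.md` v1.1 §1 (D4) «along a RATIONAL step the image of a coefficient field is a coefficient field, and the completed chart is the
monomial substitution», res-L0-w41-tri-1 `v621/KGG-signatures.md` K-GG2 (b)/(c) rational case; replaces the role of no printed item; NOT a statement of the manuscript
under review [claim: Hironaka2017, status: under-review]; AI-produced). Theses-free, definition-free. No perfectness: the coefficient field of the TARGET is CHOSEN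
as the image of a coefficient field of the source (this replaces res-D-pv-007's finite-level (Tsq) `ExpansionTransport.ringHom_comp_eq_of_generators`, whose
`u^{pⁿ}` trick needs a perfect residue field).

* `NestedFrames.ringHom_eq_of_agree` — two ring homs `Ŝ → K′⟦X⟧` agreeing on a coefficient field and on generators of `𝔪` (sent to constant-free series) agree;
* `NestedFrames.exists_section_of_rational` — along a RATIONAL local hom `ψ : A → B` a section `σ₀` of `A` NESTS: `σ_B ∘ ρ = ψ ∘ σ₀` for the residue iso `ρ`;
* `NestedFrames.exists_frame_of_section` — Cohen frame of a complete regular local ring adapted to a section AND a regular system of parameters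
  (`frame (x i) = X i`, `frame (σ c) = C c`, `constantCoeff ∘ frame = residue`; tree `comp_map_bijective`, Matsumura 29.7);
* `NestedFrames.exists_nested_frames` — **THE SQUARE**: for `φ : S → T` local and rational between regular local rings of the same dimension, parameters `x_S`,
  `x_T` with `φ (x_S i) = ∏_j x_T j ^ (A i j)`, there are frames of `Ŝ`, `T̂` and a residue isomorphism `ρ` with
  `frame_T (φ s) = ρ_* ((frame_S s)(X ↦ X^A))` for all `s ∈ S` — i.e. `S` is read in `T̂`'s coordinates by the monomial substitution `substGenerators A`.
* `NestedFrames.exists_frame_with_section`, `NestedFrames.exists_nested_frames_of_section` — the CHAINING form (prescribed `σ_S`, frame of `Ŝ`; output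
  records `σ_T`), for windows `S₀ → S₁ → S₂` (appended).
Consumers: the F♭_λ bridge (free steps `ỹᵢ = u^M wᵢ`), res-L0-w41-stub-3's I″ / the G-geom Lemma S_λ (satellite chart), K-GG2. [cite: Matsumura1987, Thm. 28.3, Thm. 29.7] [folklore]
-/

noncomputable section

set_option linter.dupNamespace false

open IsLocalRing MvPowerSeries
open Literature.AlgebraicGeometry.Resolution Literature.RingTheory.MvPowerSeries Literature.RingTheory.MvPowerSeries.monoidPowerSeries
open Summit.ResolutionOfSingularities.ResolutionOfSingularities.Theorems.SwitchingDichotomy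

namespace Summit.ResolutionOfSingularities.ResolutionOfSingularities.Theorems.SwitchingDichotomy.NestedFrames

/-! ## Agreement of two readings on a coefficient field and on generators -/

/-- **Two readings agreeing on a coefficient field and on the parameters agree.** Let `A` be a regular local ring with a section `σ` of its residue map and
generators `x` of `𝔪_A`; let `E, E′ : A → K′⟦X_τ⟧` be ring homs with `E (σ c) = E′ (σ c)`, `E (x i) = E′ (x i)` and `E (x i)`, `E′ (x i)` constant-free. Then
`E = E′` (every element is a `σ`-polynomial in `x` modulo `𝔪^N`, and both maps send `𝔪^N` into `𝔪^N`). [cite: Matsumura1987, Thm. 29.4 (proof)] -/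
theorem ringHom_eq_of_agree {A : Type} [CommRing A] [IsRegularLocalRing A] (σ : ResidueField A →+* A) (hσ : ∀ c, residue A (σ c) = c)
    {d : ℕ} (x : Fin d → A) (hx : Ideal.span (Set.range x) = maximalIdeal A)
    {K' : Type} [Field K'] {τ : Type} (E E' : A →+* MvPowerSeries τ K')
    (hEσ : ∀ c, E (σ c) = E' (σ c)) (hEx : ∀ i, E (x i) = E' (x i))
    (hE0 : ∀ i, constantCoeff (E (x i)) = 0) : E = E' := by
  classical
  have hE0' : ∀ i, constantCoeff (E' (x i)) = 0 := fun i => (hEx i) ▸ hE0 i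
  -- both maps send `𝔪_A^N` into `𝔪^N`
  have hpow : ∀ (G : A →+* MvPowerSeries τ K'), (∀ i, constantCoeff (G (x i)) = 0) → ∀ N (a : A), a ∈ maximalIdeal A ^ N →
      G a ∈ maximalIdeal (MvPowerSeries τ K') ^ N := by
    intro G hG N a ha
    have hle : (maximalIdeal A).map G ≤ maximalIdeal (MvPowerSeries τ K') := by
      rw [← hx, Ideal.map_span, Ideal.span_le]
      rintro _ ⟨_, ⟨i, rfl⟩, rfl⟩
      exact Jets.mem_maximalIdeal_iff_constantCoeff_eq_zero.mpr (hG i)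
    have := Ideal.pow_right_mono (n := N) hle
    rw [← Ideal.map_pow] at this
    exact this (Ideal.mem_map_of_mem G ha)
  -- agreement on `σ`-polynomials in `x`
  have hpoly : ∀ P : MvPolynomial (Fin d) (ResidueField A),
      E (MvPolynomial.eval x (MvPolynomial.map σ P)) = E' (MvPolynomial.eval x (MvPolynomial.map σ P)) := by
    intro P
    change E (MvPolynomial.eval₂ (RingHom.id A) x (MvPolynomial.map σ P)) = E' (MvPolynomial.eval₂ (RingHom.id A) x (MvPolynomial.map σ P))
    rw [MvPolynomial.eval₂_comp_left, MvPolynomial.eval₂_comp_left, MvPolynomial.eval₂_map, MvPolynomial.eval₂_map]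
    have h1 : (E.comp (RingHom.id A)).comp σ = (E'.comp (RingHom.id A)).comp σ := RingHom.ext fun c => by simpa using hEσ c
    have h2 : (⇑E ∘ x) = (⇑E' ∘ x) := funext fun i => hEx i
    rw [h1, h2]
  refine RingHom.ext fun a => ?_
  rw [← sub_eq_zero]
  ext e
  rw [coeff_zero]
  refine Jets.coeff_eq_zero_of_mem_maximalIdeal_pow (N := e.degree + 1) ?_ (Nat.lt_succ_self _)
  obtain ⟨P, hP⟩ := exists_mvPolynomial_sub_eval_mem_pow σ hσ x hx (e.degree + 1) a
  have h := Ideal.sub_mem _ (hpow E hE0 _ _ hP) (hpow E' hE0' _ _ hP)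
  rwa [map_sub, map_sub, hpoly, sub_sub_sub_cancel_right] at h

/-! ## Nesting a coefficient field along a rational local homomorphism -/

/-- **Coefficient fields nest along a RATIONAL local homomorphism.** If `ψ : A → B` is a local hom of local rings whose residue map is onto (every `b` is
`≡ ψ a (mod 𝔪_B)`), and `σ₀` is a section of the residue map of `A`, then `σ := ψ ∘ σ₀ ∘ ρ⁻¹` is a section of the residue map of `B`, where
`ρ : κ(A) ≃ κ(B)` is the residue isomorphism. [cite: Matsumura1987, Thm. 28.3] -/
theorem exists_section_of_rational {A B : Type} [CommRing A] [IsLocalRing A] [CommRing B] [IsLocalRing B] (ψ : A →+* B)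
    (hψ : (maximalIdeal A).map ψ ≤ maximalIdeal B) (hrat : ∀ b : B, ∃ a : A, b - ψ a ∈ maximalIdeal B)
    (σ₀ : ResidueField A →+* A) (hσ₀ : ∀ c, residue A (σ₀ c) = c) :
    ∃ (ρ : ResidueField A ≃+* ResidueField B) (σ : ResidueField B →+* B),
      (∀ c, residue B (σ c) = c) ∧ (∀ c, σ (ρ c) = ψ (σ₀ c)) ∧ ∀ a, ρ (residue A a) = residue B (ψ a) := by
  have hcomap : maximalIdeal A ≤ (maximalIdeal B).comap ψ := Ideal.map_le_iff_le_comap.mp hψ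
  let ρ₀ : ResidueField A →+* ResidueField B := Ideal.quotientMap (maximalIdeal B) ψ hcomap
  have hρ₀ : ∀ a, ρ₀ (residue A a) = residue B (ψ a) := fun a => Ideal.quotientMap_mk
  have hbij : Function.Bijective ρ₀ := by
    refine ⟨ρ₀.injective, fun c => ?_⟩
    obtain ⟨b, rfl⟩ := residue_surjective c
    obtain ⟨a, ha⟩ := hrat b
    refine ⟨residue A a, ?_⟩
    rw [hρ₀, eq_comm, ← sub_eq_zero, ← map_sub, residue_eq_zero_iff]
    exact ha
  let ρ : ResidueField A ≃+* ResidueField B := RingEquiv.ofBijective ρ₀ hbij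
  refine ⟨ρ, ψ.comp (σ₀.comp ρ.symm.toRingHom), fun c => ?_, fun c => ?_, fun a => hρ₀ a⟩
  · obtain ⟨c₀, rfl⟩ := ρ.surjective c
    rw [RingHom.comp_apply, RingHom.comp_apply, RingEquiv.toRingHom_eq_coe, RingHom.coe_coe, RingEquiv.symm_apply_apply]
    obtain ⟨a, rfl⟩ := residue_surjective c₀
    have h1 : residue B (ψ (σ₀ (residue A a))) = ρ₀ (residue A (σ₀ (residue A a))) := (hρ₀ _).symm
    rw [h1, hσ₀]
    rfl
  · rw [RingHom.comp_apply, RingHom.comp_apply, RingEquiv.toRingHom_eq_coe, RingHom.coe_coe, RingEquiv.symm_apply_apply]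

/-! ## A Cohen frame adapted to a section and to a regular system of parameters -/

/-- **Cohen frame adapted to a section and an r.s.o.p.** For a complete regular local ring `A`, a section `σ` of its residue map and a regular system of
parameters `x : Fin n → A` (`n = emb dim A`): a ring isomorphism `frame : A ≃+* κ(A)⟦X_1,…,X_n⟧` with `frame (x i) = X i`, `frame (σ c) = C c`, and
`constantCoeff (frame a) = residue a`. (Inverse of the tree's expansion map `Φ ∘ σ_*`, `comp_map_bijective`.) [cite: Matsumura1987, Thm. 29.7] -/
theorem exists_frame_of_section {A : Type} [CommRing A] [IsRegularLocalRing A] [IsAdicComplete (maximalIdeal A) A]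
    (σ : ResidueField A →+* A) (hσ : ∀ c, residue A (σ c) = c) {n : ℕ} (hn : (maximalIdeal A).spanFinrank = n)
    (x : Fin n → A) (hx : Ideal.span (Set.range x) = maximalIdeal A) :
    ∃ frame : A ≃+* MvPowerSeries (Fin n) (ResidueField A),
      (∀ i, frame (x i) = X i) ∧ (∀ c, frame (σ c) = C c) ∧ ∀ a, constantCoeff (frame a) = residue A a := by
  classical
  have hxm : ∀ i, x i ∈ maximalIdeal A := fun i => hx ▸ Ideal.subset_span ⟨i, rfl⟩
  obtain ⟨Φ, hΦ₁, hΦ₂⟩ := exists_adicEvalHom (maximalIdeal A) x hxm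
  have hbij := comp_map_bijective σ hσ hn x hx Φ hΦ₁ hΦ₂
  refine ⟨(RingEquiv.ofBijective _ hbij).symm, fun i => ?_, fun c => ?_, fun a => ?_⟩
  · rw [RingEquiv.symm_apply_eq, RingEquiv.ofBijective_apply, RingHom.comp_apply, map_X, ← MvPolynomial.coe_X, hΦ₁, MvPolynomial.eval_X]
  · rw [RingEquiv.symm_apply_eq, RingEquiv.ofBijective_apply, RingHom.comp_apply, map_C, ← MvPolynomial.coe_C, hΦ₁, MvPolynomial.eval_C]
  · -- `residue (Φ (σ_* F)) = F(0)`
    set F := (RingEquiv.ofBijective _ hbij).symm a with hF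
    have ha : a = Φ (MvPowerSeries.map σ F) := by
      rw [hF, ← RingHom.comp_apply, ← RingEquiv.ofBijective_apply (f := Φ.comp (MvPowerSeries.map σ)) (hf := hbij), RingEquiv.apply_symm_apply]
    have h1 : Φ (MvPowerSeries.map σ (C (constantCoeff F))) = σ (constantCoeff F) := by
      rw [map_C, ← MvPolynomial.coe_C, hΦ₁, MvPolynomial.eval_C]
    have h2 : Φ (MvPowerSeries.map σ (F - C (constantCoeff F))) ∈ maximalIdeal A := by
      have := hΦ₂ 1 (MvPowerSeries.map σ (F - C (constantCoeff F))) fun e he => by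
        have he0 : e = 0 := (Finsupp.degree_eq_zero_iff e).mp (by omega)
        rw [he0, coeff_map, map_sub, coeff_zero_eq_constantCoeff_apply, coeff_zero_eq_constantCoeff_apply, constantCoeff_C, sub_self, map_zero]
      rwa [pow_one] at this
    have hsplit : MvPowerSeries.map σ F = MvPowerSeries.map σ (C (constantCoeff F)) + MvPowerSeries.map σ (F - C (constantCoeff F)) := by
      rw [← map_add, add_sub_cancel]
    rw [ha, hsplit, map_add, map_add, h1, hσ, (residue_eq_zero_iff _).mpr h2, add_zero]

/-! ## The square: nested frames along a rational local homomorphism with monomial relations -/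

/-- **NESTED COHEN FRAMES (the completed chart square, rational case, any residue field).** Let `φ : S → T` be a local homomorphism of regular local
rings of characteristic `p` and the same dimension `n` whose residue map is onto (`∀ t, ∃ s, t − φ s ∈ 𝔪_T`), and let `x_S`, `x_T` be regular systems of
parameters with MONOMIAL relations `φ (x_S i) = ∏_j x_T j ^ A i j` (`A i ≠ 0`). Then there are Cohen frames `frame_S : Ŝ ≃ κ(Ŝ)⟦X⟧`, `frame_T : T̂ ≃ κ(T̂)⟦X⟧`
(adapted to `x_S`, `x_T`, reading residues as constant terms) and a residue isomorphism `ρ : κ(Ŝ) ≃ κ(T̂)` with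
`frame_T (φ s) = ρ_* ((frame_S s)(X ↦ X^A))` for every `s ∈ S`: in these coordinates `S → T` IS the monomial substitution `substGenerators A`. The coefficient
field of `T̂` is the IMAGE of that of `Ŝ` (`exists_section_of_rational`), so no uniqueness / perfectness is needed. [cite: Matsumura1987, Thm. 28.3, Thm. 29.7] -/
theorem exists_nested_frames (p : ℕ) [Fact p.Prime] {S T : Type} [CommRing S] [CommRing T] [IsRegularLocalRing S] [IsRegularLocalRing T]
    [CharP S p] [CharP T p] (φ : S →+* T) (hφ : (maximalIdeal S).map φ ≤ maximalIdeal T) (hrat : ∀ t : T, ∃ s : S, t - φ s ∈ maximalIdeal T)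
    {n : ℕ} (hS : ringKrullDim S = n) (hT : ringKrullDim T = n)
    (xS : Fin n → S) (hxS : Ideal.span (Set.range xS) = maximalIdeal S) (xT : Fin n → T) (hxT : Ideal.span (Set.range xT) = maximalIdeal T)
    (A : Fin n → (Fin n →₀ ℕ)) (hA0 : ∀ i, A i ≠ 0) (hrel : ∀ i, φ (xS i) = ∏ j, xT j ^ (A i j)) :
    ∃ (frameS : AdicCompletion (maximalIdeal S) S ≃+* MvPowerSeries (Fin n) (ResidueField (AdicCompletion (maximalIdeal S) S)))
      (frameT : AdicCompletion (maximalIdeal T) T ≃+* MvPowerSeries (Fin n) (ResidueField (AdicCompletion (maximalIdeal T) T)))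
      (ρ : ResidueField (AdicCompletion (maximalIdeal S) S) ≃+* ResidueField (AdicCompletion (maximalIdeal T) T)),
      (∀ i, frameS (algebraMap S _ (xS i)) = X i) ∧ (∀ a, constantCoeff (frameS a) = residue _ a) ∧
      (∀ i, frameT (algebraMap T _ (xT i)) = X i) ∧ (∀ b, constantCoeff (frameT b) = residue _ b) ∧
      ∀ s : S, frameT (algebraMap T _ (φ s)) =
        MvPowerSeries.map (ρ : ResidueField (AdicCompletion (maximalIdeal S) S) →+* ResidueField (AdicCompletion (maximalIdeal T) T))
          (substGenerators (R := ResidueField (AdicCompletion (maximalIdeal S) S)) A hA0 (frameS (algebraMap S _ s))) := by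
  classical
  haveI : IsNoetherianRing (AdicCompletion (maximalIdeal S) S) := isNoetherianRing_adicCompletion_maximalIdeal S
  haveI : IsRegularLocalRing (AdicCompletion (maximalIdeal S) S) := isRegularLocalRing_adicCompletion S
  haveI : CharP (AdicCompletion (maximalIdeal S) S) p := RadicandCohenFrame.charP_adicCompletion p S
  haveI : IsNoetherianRing (AdicCompletion (maximalIdeal T) T) := isNoetherianRing_adicCompletion_maximalIdeal T
  haveI : IsRegularLocalRing (AdicCompletion (maximalIdeal T) T) := isRegularLocalRing_adicCompletion T
  -- a coefficient field of `Ŝ`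
  obtain ⟨σ₀, hσ₀⟩ := Literature.RingTheory.CompleteLocalRings.exists_ringHom_comp_residue_eq_id_of_subring (AdicCompletion (maximalIdeal S) S)
    (ZMod.castHom (dvd_refl p) (AdicCompletion (maximalIdeal S) S)).range (RadicandCohenFrame.isField_range_castHom p)
  -- the completed map `ψ : Ŝ → T̂`
  have hg : (maximalIdeal S).map ((algebraMap T (AdicCompletion (maximalIdeal T) T)).comp φ) ≤ maximalIdeal (AdicCompletion (maximalIdeal T) T) := by
    rw [← Ideal.map_map, AdicCompletion.maximalIdeal_eq_map]
    exact Ideal.map_mono hφ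
  obtain ⟨ψ, hψ⟩ := Isol.exists_ringHom_adicCompletion_extend (maximalIdeal S) (maximalIdeal (AdicCompletion (maximalIdeal T) T))
    ((algebraMap T (AdicCompletion (maximalIdeal T) T)).comp φ) hg
  have hψ_of : ∀ s : S, ψ (algebraMap S _ s) = algebraMap T _ (φ s) := fun s => by
    rw [AdicCompletion.algebraMap_apply, Algebra.algebraMap_self_apply]; exact hψ s
  have hψloc : (maximalIdeal (AdicCompletion (maximalIdeal S) S)).map ψ ≤ maximalIdeal (AdicCompletion (maximalIdeal T) T) := by
    have hcomp : ψ.comp (algebraMap S (AdicCompletion (maximalIdeal S) S)) = (algebraMap T (AdicCompletion (maximalIdeal T) T)).comp φ :=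
      RingHom.ext hψ_of
    rw [AdicCompletion.maximalIdeal_eq_map, Ideal.map_map, hcomp]
    exact hg
  have hψrat : ∀ b : AdicCompletion (maximalIdeal T) T, ∃ a : AdicCompletion (maximalIdeal S) S,
      b - ψ a ∈ maximalIdeal (AdicCompletion (maximalIdeal T) T) := by
    intro b
    obtain ⟨t, ht⟩ := CompletionRecognition.exists_sub_algebraMap_mem_pow (S := T) b 1
    obtain ⟨s, hs⟩ := hrat t
    refine ⟨algebraMap S _ s, ?_⟩
    rw [pow_one] at ht
    have h2 : algebraMap T (AdicCompletion (maximalIdeal T) T) (t - φ s) ∈ maximalIdeal (AdicCompletion (maximalIdeal T) T) := by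
      rw [AdicCompletion.maximalIdeal_eq_map]; exact Ideal.mem_map_of_mem _ hs
    rw [map_sub, ← hψ_of] at h2
    have := Ideal.add_mem _ ht h2
    rwa [sub_add_sub_cancel] at this
  obtain ⟨ρ, σT, hσT, hnest, hρres⟩ := exists_section_of_rational ψ hψloc hψrat σ₀ hσ₀
  -- the two frames
  have hnS : (maximalIdeal (AdicCompletion (maximalIdeal S) S)).spanFinrank = n := by
    rw [AdicCompletion.spanFinrank_maximalIdeal_eq]
    have h := IsRegularLocalRing.spanFinrank_maximalIdeal (R := S)
    rw [hS] at h
    exact_mod_cast h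
  have hnT : (maximalIdeal (AdicCompletion (maximalIdeal T) T)).spanFinrank = n := by
    rw [AdicCompletion.spanFinrank_maximalIdeal_eq]
    have h := IsRegularLocalRing.spanFinrank_maximalIdeal (R := T)
    rw [hT] at h
    exact_mod_cast h
  have hxS' : Ideal.span (Set.range fun i => algebraMap S (AdicCompletion (maximalIdeal S) S) (xS i)) =
      maximalIdeal (AdicCompletion (maximalIdeal S) S) := by
    rw [AdicCompletion.maximalIdeal_eq_map, ← hxS, Ideal.map_span, ← Set.range_comp]; rfl
  have hxT' : Ideal.span (Set.range fun i => algebraMap T (AdicCompletion (maximalIdeal T) T) (xT i)) =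
      maximalIdeal (AdicCompletion (maximalIdeal T) T) := by
    rw [AdicCompletion.maximalIdeal_eq_map, ← hxT, Ideal.map_span, ← Set.range_comp]; rfl
  obtain ⟨frameS, hfSx, hfSσ, hfSres⟩ := exists_frame_of_section σ₀ hσ₀ hnS _ hxS'
  obtain ⟨frameT, hfTx, hfTσ, hfTres⟩ := exists_frame_of_section σT hσT hnT _ hxT'
  refine ⟨frameS, frameT, ρ, hfSx, hfSres, hfTx, hfTres, ?_⟩
  -- the square by agreement on `σ₀` and on the parameters
  have hθX : ∀ i, substGenerators (R := ResidueField (AdicCompletion (maximalIdeal S) S)) A hA0 (X i) = monomial (A i) 1 := fun i => by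
    rw [substGenerators_apply, subst_X (hasSubst_monomial A hA0)]
  have hagree := ringHom_eq_of_agree σ₀ hσ₀ _ hxS'
    (frameT.toRingHom.comp ψ)
    (((MvPowerSeries.map (ρ : ResidueField (AdicCompletion (maximalIdeal S) S) →+* ResidueField (AdicCompletion (maximalIdeal T) T))).comp
      (substGenerators (R := ResidueField (AdicCompletion (maximalIdeal S) S)) A hA0).toRingHom).comp frameS.toRingHom)
    (fun c => by
      simp only [RingHom.comp_apply, RingEquiv.toRingHom_eq_coe, RingHom.coe_coe, AlgHom.toRingHom_eq_coe]
      rw [← hnest, hfTσ, hfSσ, substGenerators_apply, subst_C, map_C]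
      rfl)
    (fun i => by
      simp only [RingHom.comp_apply, RingEquiv.toRingHom_eq_coe, RingHom.coe_coe, AlgHom.toRingHom_eq_coe]
      rw [hψ_of, hrel, map_prod, map_prod, hfSx, hθX, map_monomial, map_one]
      simp_rw [map_pow, hfTx]
      exact CompletionRecognition.prod_X_pow_eq_monomial (A i))
    (fun i => by
      simp only [RingHom.comp_apply, RingEquiv.toRingHom_eq_coe, RingHom.coe_coe]
      rw [hψ_of, hrel, map_prod, map_prod]
      simp_rw [map_pow, hfTx]
      rw [CompletionRecognition.prod_X_pow_eq_monomial (A i), ← coeff_zero_eq_constantCoeff_apply, coeff_monomial, if_neg]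
      exact fun h => hA0 i h.symm)
  intro s
  have := congrArg (fun f => f (algebraMap S (AdicCompletion (maximalIdeal S) S) s)) hagree
  simp only [RingHom.comp_apply, RingEquiv.toRingHom_eq_coe, RingHom.coe_coe, AlgHom.toRingHom_eq_coe] at this
  rw [hψ_of] at this
  exact this

/-! ## Chaining form: frames with a prescribed coefficient field (appended 2026-08-27, for the λ-twisted Lemma S: windows `S₀ → S₁ → S₂`) -/

/-- **An initial (section, frame) pair for `Ŝ`**: a coefficient field `σ` of the completion of a regular local ring `S` of characteristic `p` and dimension `n`,
and a Cohen frame adapted to `σ` AND to a given regular system of parameters `x` of `S`, reading residues as constant terms. [cite: Matsumura1987, Thm. 28.3, Thm. 29.7] -/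
theorem exists_frame_with_section (p : ℕ) [Fact p.Prime] {S : Type} [CommRing S] [IsRegularLocalRing S] [CharP S p]
    {n : ℕ} (hS : ringKrullDim S = n) (xS : Fin n → S) (hxS : Ideal.span (Set.range xS) = maximalIdeal S) :
    ∃ (σ : ResidueField (AdicCompletion (maximalIdeal S) S) →+* AdicCompletion (maximalIdeal S) S)
      (frame : AdicCompletion (maximalIdeal S) S ≃+* MvPowerSeries (Fin n) (ResidueField (AdicCompletion (maximalIdeal S) S))),
      (∀ c, residue _ (σ c) = c) ∧ (∀ i, frame (algebraMap S _ (xS i)) = X i) ∧ (∀ c, frame (σ c) = C c) ∧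
      ∀ a, constantCoeff (frame a) = residue _ a := by
  classical
  haveI : IsNoetherianRing (AdicCompletion (maximalIdeal S) S) := isNoetherianRing_adicCompletion_maximalIdeal S
  haveI : IsRegularLocalRing (AdicCompletion (maximalIdeal S) S) := isRegularLocalRing_adicCompletion S
  haveI : CharP (AdicCompletion (maximalIdeal S) S) p := RadicandCohenFrame.charP_adicCompletion p S
  obtain ⟨σ, hσ⟩ := Literature.RingTheory.CompleteLocalRings.exists_ringHom_comp_residue_eq_id_of_subring (AdicCompletion (maximalIdeal S) S)
    (ZMod.castHom (dvd_refl p) (AdicCompletion (maximalIdeal S) S)).range (RadicandCohenFrame.isField_range_castHom p)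
  have hn : (maximalIdeal (AdicCompletion (maximalIdeal S) S)).spanFinrank = n := by
    rw [AdicCompletion.spanFinrank_maximalIdeal_eq]
    have h := IsRegularLocalRing.spanFinrank_maximalIdeal (R := S)
    rw [hS] at h
    exact_mod_cast h
  have hx' : Ideal.span (Set.range fun i => algebraMap S (AdicCompletion (maximalIdeal S) S) (xS i)) =
      maximalIdeal (AdicCompletion (maximalIdeal S) S) := by
    rw [AdicCompletion.maximalIdeal_eq_map, ← hxS, Ideal.map_span, ← Set.range_comp]; rfl
  obtain ⟨frame, hfx, hfσ, hfres⟩ := exists_frame_of_section σ hσ hn _ hx'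
  exact ⟨σ, frame, hσ, hfx, hfσ, hfres⟩

/-- **NESTED COHEN FRAMES, CHAINING FORM.** As `exists_nested_frames`, but the coefficient field `σ_S` and the frame of `Ŝ` are PRESCRIBED (e.g. produced
by a previous step `S₋₁ → S`), and the output also records the nested coefficient field `σ_T` of `T̂` (`σ_T ∘ ρ = φ̂ ∘ σ_S`, `frame_T ∘ σ_T = C`) so that the
next step `T → U` can be chained on `(σ_T, frame_T)`. [cite: Matsumura1987, Thm. 28.3, Thm. 29.7] -/
theorem exists_nested_frames_of_section (p : ℕ) [Fact p.Prime] {S T : Type} [CommRing S] [CommRing T] [IsRegularLocalRing S] [IsRegularLocalRing T]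
    [CharP S p] [CharP T p] (φ : S →+* T) (hφ : (maximalIdeal S).map φ ≤ maximalIdeal T) (hrat : ∀ t : T, ∃ s : S, t - φ s ∈ maximalIdeal T)
    {n : ℕ} (hT : ringKrullDim T = n)
    (xS : Fin n → S) (hxS : Ideal.span (Set.range xS) = maximalIdeal S) (xT : Fin n → T) (hxT : Ideal.span (Set.range xT) = maximalIdeal T)
    (A : Fin n → (Fin n →₀ ℕ)) (hA0 : ∀ i, A i ≠ 0) (hrel : ∀ i, φ (xS i) = ∏ j, xT j ^ (A i j))
    (σS : ResidueField (AdicCompletion (maximalIdeal S) S) →+* AdicCompletion (maximalIdeal S) S) (hσS : ∀ c, residue _ (σS c) = c)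
    (frameS : AdicCompletion (maximalIdeal S) S ≃+* MvPowerSeries (Fin n) (ResidueField (AdicCompletion (maximalIdeal S) S)))
    (hfSx : ∀ i, frameS (algebraMap S _ (xS i)) = X i) (hfSσ : ∀ c, frameS (σS c) = C c) :
    ∃ (frameT : AdicCompletion (maximalIdeal T) T ≃+* MvPowerSeries (Fin n) (ResidueField (AdicCompletion (maximalIdeal T) T)))
      (ρ : ResidueField (AdicCompletion (maximalIdeal S) S) ≃+* ResidueField (AdicCompletion (maximalIdeal T) T))
      (σT : ResidueField (AdicCompletion (maximalIdeal T) T) →+* AdicCompletion (maximalIdeal T) T),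
      (∀ c, residue _ (σT c) = c) ∧ (∀ i, frameT (algebraMap T _ (xT i)) = X i) ∧ (∀ c, frameT (σT c) = C c) ∧
      (∀ b, constantCoeff (frameT b) = residue _ b) ∧ (∀ s : S, ρ (residue _ (algebraMap S _ s)) = residue _ (algebraMap T _ (φ s))) ∧
      ∀ s : S, frameT (algebraMap T _ (φ s)) =
        MvPowerSeries.map (ρ : ResidueField (AdicCompletion (maximalIdeal S) S) →+* ResidueField (AdicCompletion (maximalIdeal T) T))
          (substGenerators (R := ResidueField (AdicCompletion (maximalIdeal S) S)) A hA0 (frameS (algebraMap S _ s))) := by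
  classical
  haveI : IsNoetherianRing (AdicCompletion (maximalIdeal S) S) := isNoetherianRing_adicCompletion_maximalIdeal S
  haveI : IsRegularLocalRing (AdicCompletion (maximalIdeal S) S) := isRegularLocalRing_adicCompletion S
  haveI : IsNoetherianRing (AdicCompletion (maximalIdeal T) T) := isNoetherianRing_adicCompletion_maximalIdeal T
  haveI : IsRegularLocalRing (AdicCompletion (maximalIdeal T) T) := isRegularLocalRing_adicCompletion T
  -- the completed map `ψ : Ŝ → T̂` (as in `exists_nested_frames`)
  have hg : (maximalIdeal S).map ((algebraMap T (AdicCompletion (maximalIdeal T) T)).comp φ) ≤ maximalIdeal (AdicCompletion (maximalIdeal T) T) := by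
    rw [← Ideal.map_map, AdicCompletion.maximalIdeal_eq_map]
    exact Ideal.map_mono hφ
  obtain ⟨ψ, hψ⟩ := Isol.exists_ringHom_adicCompletion_extend (maximalIdeal S) (maximalIdeal (AdicCompletion (maximalIdeal T) T))
    ((algebraMap T (AdicCompletion (maximalIdeal T) T)).comp φ) hg
  have hψ_of : ∀ s : S, ψ (algebraMap S _ s) = algebraMap T _ (φ s) := fun s => by
    rw [AdicCompletion.algebraMap_apply, Algebra.algebraMap_self_apply]; exact hψ s
  have hψloc : (maximalIdeal (AdicCompletion (maximalIdeal S) S)).map ψ ≤ maximalIdeal (AdicCompletion (maximalIdeal T) T) := by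
    have hcomp : ψ.comp (algebraMap S (AdicCompletion (maximalIdeal S) S)) = (algebraMap T (AdicCompletion (maximalIdeal T) T)).comp φ :=
      RingHom.ext hψ_of
    rw [AdicCompletion.maximalIdeal_eq_map, Ideal.map_map, hcomp]
    exact hg
  have hψrat : ∀ b : AdicCompletion (maximalIdeal T) T, ∃ a : AdicCompletion (maximalIdeal S) S,
      b - ψ a ∈ maximalIdeal (AdicCompletion (maximalIdeal T) T) := by
    intro b
    obtain ⟨t, ht⟩ := CompletionRecognition.exists_sub_algebraMap_mem_pow (S := T) b 1
    obtain ⟨s, hs⟩ := hrat t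
    refine ⟨algebraMap S _ s, ?_⟩
    rw [pow_one] at ht
    have h2 : algebraMap T (AdicCompletion (maximalIdeal T) T) (t - φ s) ∈ maximalIdeal (AdicCompletion (maximalIdeal T) T) := by
      rw [AdicCompletion.maximalIdeal_eq_map]; exact Ideal.mem_map_of_mem _ hs
    rw [map_sub, ← hψ_of] at h2
    have := Ideal.add_mem _ ht h2
    rwa [sub_add_sub_cancel] at this
  obtain ⟨ρ, σT, hσT, hnest, hρres⟩ := exists_section_of_rational ψ hψloc hψrat σS hσS
  have hnT : (maximalIdeal (AdicCompletion (maximalIdeal T) T)).spanFinrank = n := by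
    rw [AdicCompletion.spanFinrank_maximalIdeal_eq]
    have h := IsRegularLocalRing.spanFinrank_maximalIdeal (R := T)
    rw [hT] at h
    exact_mod_cast h
  have hxS' : Ideal.span (Set.range fun i => algebraMap S (AdicCompletion (maximalIdeal S) S) (xS i)) =
      maximalIdeal (AdicCompletion (maximalIdeal S) S) := by
    rw [AdicCompletion.maximalIdeal_eq_map, ← hxS, Ideal.map_span, ← Set.range_comp]; rfl
  have hxT' : Ideal.span (Set.range fun i => algebraMap T (AdicCompletion (maximalIdeal T) T) (xT i)) =
      maximalIdeal (AdicCompletion (maximalIdeal T) T) := by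
    rw [AdicCompletion.maximalIdeal_eq_map, ← hxT, Ideal.map_span, ← Set.range_comp]; rfl
  obtain ⟨frameT, hfTx, hfTσ, hfTres⟩ := exists_frame_of_section σT hσT hnT _ hxT'
  refine ⟨frameT, ρ, σT, hσT, hfTx, hfTσ, hfTres, fun s => (hρres _).trans (by rw [hψ_of]), ?_⟩
  have hθX : ∀ i, substGenerators (R := ResidueField (AdicCompletion (maximalIdeal S) S)) A hA0 (X i) = monomial (A i) 1 := fun i => by
    rw [substGenerators_apply, subst_X (hasSubst_monomial A hA0)]
  have hagree := ringHom_eq_of_agree σS hσS _ hxS'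
    (frameT.toRingHom.comp ψ)
    (((MvPowerSeries.map (ρ : ResidueField (AdicCompletion (maximalIdeal S) S) →+* ResidueField (AdicCompletion (maximalIdeal T) T))).comp
      (substGenerators (R := ResidueField (AdicCompletion (maximalIdeal S) S)) A hA0).toRingHom).comp frameS.toRingHom)
    (fun c => by
      simp only [RingHom.comp_apply, RingEquiv.toRingHom_eq_coe, RingHom.coe_coe, AlgHom.toRingHom_eq_coe]
      rw [← hnest, hfTσ, hfSσ, substGenerators_apply, subst_C, map_C]
      rfl)
    (fun i => by
      simp only [RingHom.comp_apply, RingEquiv.toRingHom_eq_coe, RingHom.coe_coe, AlgHom.toRingHom_eq_coe]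
      rw [hψ_of, hrel, map_prod, map_prod, hfSx, hθX, map_monomial, map_one]
      simp_rw [map_pow, hfTx]
      exact CompletionRecognition.prod_X_pow_eq_monomial (A i))
    (fun i => by
      simp only [RingHom.comp_apply, RingEquiv.toRingHom_eq_coe, RingHom.coe_coe]
      rw [hψ_of, hrel, map_prod, map_prod]
      simp_rw [map_pow, hfTx]
      rw [CompletionRecognition.prod_X_pow_eq_monomial (A i), ← coeff_zero_eq_constantCoeff_apply, coeff_monomial, if_neg]
      exact fun h => hA0 i h.symm)
  intro s
  have := congrArg (fun f => f (algebraMap S (AdicCompletion (maximalIdeal S) S) s)) hagree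
  simp only [RingHom.comp_apply, RingEquiv.toRingHom_eq_coe, RingHom.coe_coe, AlgHom.toRingHom_eq_coe] at this
  rw [hψ_of] at this
  exact this

end Summit.ResolutionOfSingularities.ResolutionOfSingularities.Theorems.SwitchingDichotomy.NestedFrames

end
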